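import Mathlib.Algebra.BigOperators.Group.List.Basic
import Mathlib.Algebra.Group.Basic
import Mathlib.Tactic.Abel

/-!
# ShardSum — typed assembly of a SHARDED additive identity check (workfile, UNREGISTERED; hub-lb sym-plan-2 g1)

Bears on `stmt-Ventures-22024` (`M3x2EdgeSplit.LowerEdge_ge_m83o100`) and its twin `stmt-Ventures-21721`
(`M3PrimeEdgeSplit.LowerEdge_ge_m4o5`) ONLY through the computational lane (checklist L6): it types what a
multi-call ("sharded") replay of the word-polynomial identity of a `SymCert` (line `symreplay`, sym-plan-1) must
prove per farm call and how the per-call theorems assemble.  It proves NO crux and NO summit statement.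

## The abstract setting
A syntactic polynomial is a `List T` of terms (symreplay: `QPoly := List (ℚ × Word)`); the syntactic sum of two
polynomials is `++`; `ev : List T → M` is an ADDITIVE evaluation into an additive commutative group
(symreplay: `polyOp Λ' : QPoly → FermionOp Λ'`); `psub` is a syntactic difference and `isZero` a SOUND zero test
(symreplay: `psub`, `isZero`, soundness = `isZero_sound`).  A normaliser `pipe : List T → List T`
(symreplay: `collect ∘ nfPoly`, or `collect2 ∘ …`, or an id-indexed accumulator read back as a list) enters only
through per-shard faithfulness hypotheses `ev (pipe l) = ev l` — in symreplay these are `collect_eval` +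
S1 `NfFaithful` and hold for polynomials supported in the frame, which is why they are hypotheses on the shards
actually used and not laws of the kit.

## What a sharded certificate must ship (the byte term)
`shard_sound`: farm call `j` proves `isZero (psub (pipe L_j) P_j) = true` where `L_j` is ITS slice of the
certificate's term list and `P_j` is a LITERAL partial normal form; one more call proves
`isZero (pipe (P_1 ++ … ++ P_J)) = true`; the assembly concludes `ev (L_1 ++ … ++ L_J) = 0`, i.e. exactly the
operator identity S4 (`stub_soundOfKernels`) extracts today from the monolithic `identityOK`.  The statements of
the per-call theorems CONTAIN the `P_j`: a theorem statement is the only object that crosses a farm-call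
boundary, so `Σ_j |P_j|` is shipped as source text — the cross-shard byte term priced on the hub-lb bus
(sym-ref-1 08:48:16Z; this seat's memo `SHARD-ASSEMBLY-symplan2.md`).  `telescope_sound` is the running-sum
variant (ship `S_j := pipe (S_{j-1} ++ pipe L_j)` instead of `P_j`; same byte law with `|S_j|` = words opened
and not yet cancelled).

`lean check`: rc 0, 0 sorry.  No `instance`, no `notation`.
-/

namespace Summit.Ventures.CertifiedManyBodySolver.Cruxes.LowerEdge_ge_m83o100.ShardSum

universe u v

/-- The three operations a shard assembly needs from a syntactic-polynomial checker, with their soundness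
laws (all UNCONDITIONAL in symreplay: linearity of `polyOp`, `polyOp (psub p q) = polyOp p - polyOp q`,
`isZero_sound`). -/
structure EvalKit (T : Type u) (M : Type v) [AddCommGroup M] where
  /-- additive evaluation of a term list (symreplay: `polyOp Λ'`) -/
  ev : List T → M
  /-- syntactic difference (symreplay: `psub p q = p ++ pscale (-1) q`) -/
  psub : List T → List T → List T
  /-- syntactic zero test (symreplay: `isZero` = all coefficients zero after collection) -/
  isZero : List T → Bool
  ev_append : ∀ p q, ev (p ++ q) = ev p + ev q
  ev_psub : ∀ p q, ev (psub p q) = ev p - ev q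
  isZero_sound : ∀ p, isZero p = true → ev p = 0

namespace EvalKit

variable {T : Type u} {M : Type v} [AddCommGroup M] (K : EvalKit T M)

theorem ev_nil : K.ev [] = 0 := by
  have h := K.ev_append [] []
  rw [List.append_nil] at h
  -- h : K.ev [] = K.ev [] + K.ev []
  have : K.ev [] + K.ev [] = K.ev [] + 0 := by rw [add_zero]; exact h.symm
  exact add_left_cancel this

/-- Evaluation of a concatenation of shards is the sum of the shard evaluations. -/
theorem ev_flatten : ∀ L : List (List T), K.ev L.flatten = (L.map K.ev).sum
  | [] => by simpa using K.ev_nil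
  | l :: L => by rw [List.flatten_cons, K.ev_append, List.map_cons, List.sum_cons, ev_flatten L]

/-- A passing syntactic comparison transfers evaluations. -/
theorem ev_eq_of_isZero_psub {p q : List T} (h : K.isZero (K.psub p q) = true) : K.ev p = K.ev q := by
  have h0 := K.isZero_sound _ h
  rw [K.ev_psub] at h0
  exact sub_eq_zero.mp h0

/-- Per-shard syntactic certificates transfer the list of shard evaluations to the shipped partials. -/
theorem map_ev_eq_of_shards (pipe : List T → List T) {L P : List (List T)}
    (hpipe : ∀ l ∈ L, K.ev (pipe l) = K.ev l)
    (hshard : List.Forall₂ (fun l p => K.isZero (K.psub (pipe l) p) = true) L P) :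
    L.map K.ev = P.map K.ev := by
  induction hshard with
  | nil => rfl
  | @cons l p L' P' hlp _ ih =>
      rw [List.map_cons, List.map_cons, ← hpipe l (by simp), K.ev_eq_of_isZero_psub hlp,
        ih (fun l' hl' => hpipe l' (by simp [hl']))]

/-- **Shard assembly (partial-sum form).**  Shards `L = [L_1, …, L_J]`, shipped literal partials
`P = [P_1, …, P_J]`; call `j` certifies `pipe L_j ≡ P_j` syntactically, one call certifies `pipe (P_1 ++ … ++ P_J) ≡ 0`;
`pipe` is faithful on every list it is applied to.  Conclusion: the whole term list evaluates to `0`. -/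
theorem shard_sound (pipe : List T → List T) {L P : List (List T)}
    (hpipe : ∀ l ∈ L, K.ev (pipe l) = K.ev l)
    (hshard : List.Forall₂ (fun l p => K.isZero (K.psub (pipe l) p) = true) L P)
    (hpipeP : K.ev (pipe P.flatten) = K.ev P.flatten)
    (hsum : K.isZero (pipe P.flatten) = true) :
    K.ev L.flatten = 0 := by
  rw [K.ev_flatten, K.map_ev_eq_of_shards pipe hpipe hshard, ← K.ev_flatten, ← hpipeP]
  exact K.isZero_sound _ hsum

/-- The shipped partials themselves sum to zero semantically (what the assembly call certifies). -/
theorem ev_partials_eq_zero (pipe : List T → List T) {P : List (List T)}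
    (hpipeP : K.ev (pipe P.flatten) = K.ev P.flatten) (hsum : K.isZero (pipe P.flatten) = true) :
    (P.map K.ev).sum = 0 := by
  rw [← K.ev_flatten, ← hpipeP]; exact K.isZero_sound _ hsum

/-- **Shard assembly (running-sum / telescoping form).**  Running sums `S = [S_0, S_1, …, S_J]` with
call `j` certifying `pipe (S_{j-1} ++ L_j) ≡ S_j`; then `ev (L_1 ++ … ++ L_J) = ev S_J - ev S_0`
(use `S_0 = []` and a final `isZero S_J` to get `0`, cf. `telescope_zero`). -/
theorem telescope_sound (pipe : List T → List T) :
    ∀ (S₀ : List T) (L S : List (List T)),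
      (∀ p, K.ev (pipe p) = K.ev p) →
      List.Forall₂ (fun (l : List T) (s : List T × List T) => K.isZero (K.psub (pipe (s.1 ++ l)) s.2) = true)
        L (List.zip (S₀ :: S) S) →
      L.length = S.length →
      K.ev L.flatten = K.ev ((S₀ :: S).getLast (List.cons_ne_nil _ _)) - K.ev S₀
  | S₀, [], [], _, _, _ => by simp [K.ev_nil]
  | S₀, [], _ :: _, _, _, hlen => by simp at hlen
  | S₀, _ :: _, [], _, _, hlen => by simp at hlen
  | S₀, l :: L, s :: S, hpipe, hstep, hlen => by
      rw [List.zip_cons_cons] at hstep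
      obtain ⟨h1, hrest⟩ := List.forall₂_cons.mp hstep
      have hs : K.ev s = K.ev S₀ + K.ev l := by
        have := K.ev_eq_of_isZero_psub h1
        rw [hpipe, K.ev_append] at this
        exact this.symm
      have ih := telescope_sound pipe s L S hpipe hrest (by simpa using hlen)
      rw [List.flatten_cons, K.ev_append]
      have hlast : (S₀ :: s :: S).getLast (List.cons_ne_nil _ _) = (s :: S).getLast (List.cons_ne_nil _ _) := by
        simp [List.getLast_cons]
      rw [hlast, ih, hs]
      abel

/-- Telescoping from `S_0 = []` to a syntactically zero `S_J` gives the identity. -/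
theorem telescope_zero (pipe : List T → List T) (L S : List (List T))
    (hpipe : ∀ p, K.ev (pipe p) = K.ev p)
    (hstep : List.Forall₂ (fun (l : List T) (s : List T × List T) =>
        K.isZero (K.psub (pipe (s.1 ++ l)) s.2) = true) L (List.zip ([] :: S) S))
    (hlen : L.length = S.length)
    (hlast : K.isZero (([] :: S).getLast (List.cons_ne_nil _ _)) = true) :
    K.ev L.flatten = 0 := by
  rw [K.telescope_sound pipe [] L S hpipe hstep hlen, K.isZero_sound _ hlast, K.ev_nil, sub_zero]

/-- How three NAMED per-call theorems (the shape a `Certificates/<slug>/Check_j.lean` module would export)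
assemble: no index bookkeeping is needed, `List.Forall₂` is built by `cons`. -/
example (pipe : List T → List T) (L₁ L₂ L₃ P₁ P₂ P₃ : List T)
    (f₁ : K.ev (pipe L₁) = K.ev L₁) (f₂ : K.ev (pipe L₂) = K.ev L₂) (f₃ : K.ev (pipe L₃) = K.ev L₃)
    (check₁ : K.isZero (K.psub (pipe L₁) P₁) = true) (check₂ : K.isZero (K.psub (pipe L₂) P₂) = true)
    (check₃ : K.isZero (K.psub (pipe L₃) P₃) = true)
    (fP : K.ev (pipe (P₁ ++ P₂ ++ P₃)) = K.ev (P₁ ++ P₂ ++ P₃))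
    (final : K.isZero (pipe (P₁ ++ P₂ ++ P₃)) = true) :
    K.ev (L₁ ++ L₂ ++ L₃) = 0 := by
  have h := K.shard_sound pipe (L := [L₁, L₂, L₃]) (P := [P₁, P₂, P₃])
    (by intro l hl; simp only [List.mem_cons, List.not_mem_nil, or_false] at hl
        rcases hl with rfl | rfl | rfl <;> assumption)
    (List.Forall₂.cons check₁ (List.Forall₂.cons check₂ (List.Forall₂.cons check₃ List.Forall₂.nil)))
    (by simpa [List.flatten] using fP) (by simpa [List.flatten] using final)
  simpa [List.flatten] using h

end EvalKit

/-! ## A concrete inhabitant (consistency of the laws) and an end-to-end kernel run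
`T := ℤ × ℕ` (coefficient, variable id), `M := ℕ → ℤ` (coefficient functions), `ev` = coefficient extraction,
`psub p q := p ++ negate q`, `isZero` = every id occurring has coefficient sum `0` (a collect-free zero test). -/
namespace Toy

/-- coefficient of variable `i` in the term list `p` -/
def coeff (p : List (ℤ × ℕ)) (i : ℕ) : ℤ := ((p.filter fun t => t.2 == i).map Prod.fst).sum

def pneg (q : List (ℤ × ℕ)) : List (ℤ × ℕ) := q.map fun t => (-t.1, t.2)

def psub (p q : List (ℤ × ℕ)) : List (ℤ × ℕ) := p ++ pneg q

def isZero (p : List (ℤ × ℕ)) : Bool := p.all fun t => coeff p t.2 == 0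

theorem coeff_append (p q : List (ℤ × ℕ)) (i : ℕ) : coeff (p ++ q) i = coeff p i + coeff q i := by
  simp [coeff, List.filter_append, List.map_append, List.sum_append]

theorem coeff_pneg (q : List (ℤ × ℕ)) (i : ℕ) : coeff (pneg q) i = -coeff q i := by
  induction q with
  | nil => simp [coeff, pneg]
  | cons t q ih =>
      have ih' : ((List.filter (fun t => t.2 == i) (pneg q)).map Prod.fst).sum
          = -((List.filter (fun t => t.2 == i) q).map Prod.fst).sum := ih
      by_cases h : t.2 = i
      · simp [coeff, pneg, h] at ih' ⊢
        rw [ih']; abel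
      · simp [coeff, pneg, h] at ih' ⊢
        exact ih'

theorem coeff_eq_zero_of_not_mem (p : List (ℤ × ℕ)) (i : ℕ) (h : ∀ t ∈ p, t.2 ≠ i) : coeff p i = 0 := by
  have : p.filter (fun t => t.2 == i) = [] := by
    rw [List.filter_eq_nil_iff]; intro t ht; simpa using h t ht
  simp [coeff, this]

/-- The toy kit: all three laws proved. -/
def kit : EvalKit (ℤ × ℕ) (ℕ → ℤ) where
  ev := coeff
  psub := psub
  isZero := isZero
  ev_append p q := by funext i; exact coeff_append p q i
  ev_psub p q := by
    funext i
    show coeff (p ++ pneg q) i = coeff p i - coeff q i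
    rw [coeff_append, coeff_pneg, sub_eq_add_neg]
  isZero_sound p h := by
    funext i
    by_cases hi : ∃ t ∈ p, t.2 = i
    · obtain ⟨t, ht, rfl⟩ := hi
      have := List.all_eq_true.mp h t ht
      simpa using this
    · push Not at hi
      simpa using coeff_eq_zero_of_not_mem p i hi

/-- End to end in the kernel: three shards of the identity `(x₀ + 2x₁) + (−x₀ + x₂) + (−2x₁ − x₂) = 0`
with shipped partials and `pipe := id`. -/
example : kit.ev ([[(1, 0), (2, 1)], [(-1, 0), (1, 2)], [(-2, 1), (-1, 2)]] : List (List (ℤ × ℕ))).flatten = 0 :=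
  kit.shard_sound id (P := [[(1, 0), (2, 1)], [(-1, 0), (1, 2)], [(-2, 1), (-1, 2)]])
    (fun _ _ => rfl) (by decide) rfl (by decide)

end Toy

end Summit.Ventures.CertifiedManyBodySolver.Cruxes.LowerEdge_ge_m83o100.ShardSum
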